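import Summits.ResolutionOfSingularities.ResolutionOfSingularities.Theses.FoliationDescent
import Literature.AlgebraicGeometry.Resolution.RegularLocalRingsUFD
import Literature.RingTheory.Localization.DerivationFractionField
import HarnessLib

/-!
# Crux `FolLU` (stmt-ResolutionOfSingularities-17081), line `birth` — stub `stub_saturation`

**Saturated rescaling of a derivation on the local ring at the centre.**
Let `k ⊆ K` be fields, `O` a valuation ring of `K`, `S ⊆ O` a finitely generated `k`-subalgebra
with `Frac S = K` whose local ring `S_c = S_𝔭` (`𝔭 = S ∩ 𝔪_O`) at the centre of `O` is regular,
and `D ≠ 0` a `k`-derivation of `K`. Then there is `g ∈ K`, `g ≠ 0`, such that `g • D` maps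
`S_c` into itself and is SATURATED there: no non-zero non-unit `t ∈ S_c` divides all the values
`(g • D)(x)`, `x ∈ S_c`.

Proof (the routine normalisation of [Rudakov–Shafarevich 1976, §1], [Posva 2023, §2]):
(1) a common denominator `g₀ ∈ S ∖ 0` of `D s₁, …, D sₙ` (generators of `S`) gives
`g₀ D(S) ⊆ S` (Leibniz rule along `Algebra.adjoin_induction`) and then `g₀ D(S_c) ⊆ S_c`
(quotient rule); (2) `S_c` is realised inside `K` as `Localization.subalgebra.ofField`, is a
regular local ring (transport along `Localization.algEquiv`), hence a Noetherian UFD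
(Auslander–Buchsbaum); (3) with `f = gcd` of a finite generating family of the ideal spanned by the
values `g₀ D x`, `x ∈ S_c` (`f ≠ 0` because a derivation of `K = Frac S` vanishing on `S`
vanishes), `g := g₀ / f` works: if `t f` divides all values then `t f ∣ f`, so `t` is a unit.

References: A. N. Rudakov, I. R. Shafarevich, *Inseparable morphisms of algebraic surfaces*,
Izv. Akad. Nauk SSSR 40 (1976), §1; Q. Posva, *Resolution of 1-foliations on varieties of
dimension at most three in positive characteristic* (arXiv:2311.16694), §2.
-/

set_option linter.dupNamespace false -- mandated namespace of this single-conjunct summit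

noncomputable section

open Literature.AlgebraicGeometry.Resolution

namespace Summit.ResolutionOfSingularities.ResolutionOfSingularities.Theorems.FolLU

/-- In a valuation subring `O` of `K`, an element `b` lies outside the maximal ideal iff it is a
unit of `O`, iff `b ≠ 0` and `b⁻¹ ∈ O`. [folklore] -/
theorem not_mem_maximalIdeal_iff_inv_mem {K : Type*} [Field K] (O : ValuationSubring K) (b : O) :
    b ∉ IsLocalRing.maximalIdeal O ↔ ((b : K) ≠ 0 ∧ (b : K)⁻¹ ∈ O) := by
  rw [← ValuationSubring.coe_mem_nonunits_iff, ValuationSubring.mem_nonunits_iff_or, not_or,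
    not_not]

/-- **The local ring at the centre as a subring of `K`.** For `S ⊆ O` with `Frac S = K` and
`𝔭 = S ∩ 𝔪_O`, the localisation `S_𝔭` realised inside `K` (`Localization.subalgebra.ofField`)
consists exactly of the fractions `a / b`, `a b ∈ S`, `b` a unit of `O`; if `S_𝔭` is a regular
local ring it is a Noetherian unique factorisation domain (Auslander–Buchsbaum).
[cite: Matsumura1987, Thm. 20.3 (PDF p. 179)] -/
theorem exists_centre_subalgebra {k K : Type} [Field k] [Field K] [Algebra k K]
    (O : ValuationSubring K) (S : Subalgebra k K) (hS : S.toSubring ≤ O.toSubring)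
    (hfrac : IsFractionRing S K)
    (hreg : IsRegularLocalRing
      (Localization.AtPrime (Ideal.comap (Subring.inclusion hS) (IsLocalRing.maximalIdeal O)))) :
    ∃ T : Subalgebra S.toSubring K, IsNoetherianRing T ∧ UniqueFactorizationMonoid T ∧
      ∀ x : K, x ∈ T ↔ ∃ a b : K, a ∈ S ∧ b ∈ S ∧ b ≠ 0 ∧ b⁻¹ ∈ O ∧ x = a / b := by
  set P : Ideal S.toSubring := Ideal.comap (Subring.inclusion hS) (IsLocalRing.maximalIdeal O)
    with hP
  haveI hfrac' : IsFractionRing S.toSubring K := hfrac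
  have hM : P.primeCompl ≤ nonZeroDivisors S.toSubring := P.primeCompl_le_nonZeroDivisors
  have hregT : IsRegularLocalRing (Localization.subalgebra.ofField K P.primeCompl hM) :=
    IsRegularLocalRing.of_ringEquiv
      (Localization.algEquiv P.primeCompl
        (Localization.subalgebra.ofField K P.primeCompl hM)).toRingEquiv
  have hPc : ∀ s : S.toSubring, s ∈ P.primeCompl ↔ ((s : K) ≠ 0 ∧ (s : K)⁻¹ ∈ O) := by
    intro s
    rw [Ideal.mem_primeCompl_iff, hP, Ideal.mem_comap, not_mem_maximalIdeal_iff_inv_mem]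
    rfl
  refine ⟨Localization.subalgebra.ofField K P.primeCompl hM, inferInstance,
    IsRegularLocalRing.uniqueFactorizationMonoid _, fun x => ?_⟩
  constructor
  · rintro ⟨a, s, hs, rfl⟩
    obtain ⟨hs0, hsinv⟩ := (hPc s).mp hs
    exact ⟨a, s, a.2, s.2, hs0, hsinv, by rw [div_eq_mul_inv]; rfl⟩
  · rintro ⟨a, b, ha, hb, hb0, hbinv, rfl⟩
    exact ⟨⟨a, ha⟩, ⟨b, hb⟩, (hPc ⟨b, hb⟩).mpr ⟨hb0, hbinv⟩, by rw [div_eq_mul_inv]; rfl⟩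

/-- **Common denominator.** For a finitely generated subalgebra `S` of `K = Frac S` and a
derivation `D` of `K` there is `g₀ ∈ S`, `g₀ ≠ 0`, with `g₀ · D(S) ⊆ S` (clear the denominators of
the derivatives of the generators, then use the Leibniz rule). [folklore] -/
theorem exists_common_denominator {k K : Type*} [Field k] [Field K] [Algebra k K]
    (S : Subalgebra k K) (hfg : S.FG) (hfrac : IsFractionRing S K) (D : Derivation k K K) :
    ∃ g₀ : K, g₀ ∈ S ∧ g₀ ≠ 0 ∧ ∀ x ∈ S, g₀ * D x ∈ S := by
  classical
  obtain ⟨t, ht⟩ := hfg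
  have hden : ∀ x : K, ∃ d : K, d ∈ S ∧ d ≠ 0 ∧ d * D x ∈ S := by
    intro x
    obtain ⟨a, b, hb, hab⟩ := IsFractionRing.div_surjective (A := S) (D x)
    have hb0 : (b : K) ≠ 0 := by
      have hb' : b ≠ 0 := nonZeroDivisors.ne_zero hb
      exact fun h => hb' (Subtype.ext h)
    refine ⟨b, b.2, hb0, ?_⟩
    rw [← hab]
    change (b : K) * ((a : K) / (b : K)) ∈ S
    rw [mul_div_assoc', mul_div_cancel_left₀ _ hb0]
    exact a.2
  choose d hdS hd0 hdD using hden
  refine ⟨∏ s ∈ t, d s, prod_mem fun s _ => hdS s,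
    Finset.prod_ne_zero_iff.mpr fun s _ => hd0 s, ?_⟩
  intro x hx
  rw [← ht] at hx
  induction hx using Algebra.adjoin_induction with
  | mem x hxt =>
    rw [← Finset.mul_prod_erase t d hxt, mul_right_comm]
    exact mul_mem (hdD x) (prod_mem fun s _ => hdS s)
  | algebraMap r =>
    rw [Derivation.map_algebraMap, mul_zero]
    exact zero_mem _
  | add x y _ _ ihx ihy =>
    rw [map_add, mul_add]
    exact add_mem ihx ihy
  | mul x y hx hy ihx ihy =>
    rw [Derivation.leibniz, smul_eq_mul, smul_eq_mul, mul_add, mul_left_comm _ x,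
      mul_left_comm _ y]
    rw [ht] at hx hy
    exact add_mem (mul_mem hx ihy) (mul_mem hy ihx)

/-- **Quotient rule.** If `g₀ · D(S) ⊆ S` and every element of a subring `T ⊇ S` of `K` is a
fraction `a / b` with `a b ∈ S` and `b⁻¹ ∈ T`, then `g₀ · D(T) ⊆ T`. [folklore] -/
theorem mul_deriv_mem_of_frac {k K A : Type*} [Field k] [Field K] [Algebra k K] [CommRing A]
    [Algebra A K] (D : Derivation k K K) (S : Subalgebra k K) (T : Subalgebra A K) (g₀ : K)
    (hST : ∀ x ∈ S, x ∈ T)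
    (hT : ∀ x ∈ T, ∃ a b : K, a ∈ S ∧ b ∈ S ∧ b ≠ 0 ∧ b⁻¹ ∈ T ∧ x = a / b)
    (hg₀ : ∀ x ∈ S, g₀ * D x ∈ S) : ∀ x ∈ T, g₀ * D x ∈ T := by
  intro x hx
  obtain ⟨a, b, ha, hb, -, hbinv, rfl⟩ := hT x hx
  have h : g₀ * D (a / b) = b⁻¹ ^ 2 * (b * (g₀ * D a) - a * (g₀ * D b)) := by
    rw [Derivation.leibniz_div]
    simp only [smul_eq_mul]
    ring
  rw [h]
  exact mul_mem (pow_mem hbinv 2)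
    (sub_mem (mul_mem (hST b hb) (hST _ (hg₀ a ha))) (mul_mem (hST a ha) (hST _ (hg₀ b hb))))

/-- **A non-zero derivation of `K = Frac S` does not vanish on `S`.** [folklore] -/
theorem exists_mem_deriv_ne_zero {k K : Type*} [Field k] [Field K] [Algebra k K]
    (S : Subalgebra k K) (hfrac : IsFractionRing S K) (D : Derivation k K K) (hD : D ≠ 0) :
    ∃ a ∈ S, D a ≠ 0 := by
  by_contra h
  push Not at h
  haveI := hfrac
  exact hD (D.eq_zero_of_forall_algebraMap (A := S) fun a => h a a.2)

/-- A finite family in a unique factorisation domain has a greatest common divisor. [folklore] -/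
theorem exists_finset_gcd {R : Type*} [CommRing R] [IsDomain R] [UniqueFactorizationMonoid R]
    (w : Finset R) : ∃ f : R, (∀ z ∈ w, f ∣ z) ∧ ∀ g : R, (∀ z ∈ w, g ∣ z) → g ∣ f := by
  classical
  letI := UniqueFactorizationMonoid.toGCDMonoid R
  induction w using Finset.induction_on with
  | empty => exact ⟨0, by simp, fun g _ => dvd_zero g⟩
  | insert a w _ ih =>
    obtain ⟨f, hf, hg⟩ := ih
    refine ⟨gcd a f, fun z hz => ?_, fun g hgz => ?_⟩
    · rcases Finset.mem_insert.mp hz with rfl | hz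
      · exact gcd_dvd_left _ _
      · exact (gcd_dvd_right _ _).trans (hf z hz)
    · exact dvd_gcd (hgz a (Finset.mem_insert_self a w))
        (hg g fun z hz => hgz z (Finset.mem_insert_of_mem hz))

/-- **Saturation by the gcd of the values (the UFD step).** Let `T ⊆ K` be a subring which is a
Noetherian UFD and `δ : K → K` a map with `δ(T) ⊆ T`, `δ|_T ≠ 0`. With `f` the gcd of (a finite
generating family of the ideal spanned by) the values `δ x`, `x ∈ T`: `f ≠ 0`, `δ(T)/f ⊆ T`, and
a non-zero `t ∈ T` dividing all `δ x / f` is a unit of `T` (`t f ∣ f`).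
[cite: RudakovShafarevich1976, §1] -/
theorem exists_saturating_denominator {A K : Type*} [CommRing A] [Field K] [Algebra A K]
    (T : Subalgebra A K) [IsNoetherianRing T] [UniqueFactorizationMonoid T]
    (δ : K → K) (hpres : ∀ x ∈ T, δ x ∈ T) (hne : ∃ x ∈ T, δ x ≠ 0) :
    ∃ f : K, f ∈ T ∧ f ≠ 0 ∧ (∀ x ∈ T, δ x / f ∈ T) ∧
      ∀ t ∈ T, t ≠ 0 → (∀ x ∈ T, δ x / f / t ∈ T) → t⁻¹ ∈ T := by
  obtain ⟨x₀, hx₀T, hx₀⟩ := hne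
  -- the value map `v : T → T`, `y ↦ δ y`, and the ideal `I = (δ T)` of `T`
  obtain ⟨v, hv⟩ : ∃ v : T → T, ∀ y, (v y : K) = δ y :=
    ⟨fun y => ⟨δ y, hpres y y.2⟩, fun y => rfl⟩
  have hvI : ∀ y, v y ∈ Ideal.span (Set.range v) := fun y => Ideal.subset_span ⟨y, rfl⟩
  -- `T` Noetherian: `I` is generated by a finite family `w`
  obtain ⟨w, hw⟩ := IsNoetherian.noetherian (Ideal.span (Set.range v))
  have hwI : ∀ z ∈ w, z ∈ Ideal.span (Set.range v) := by
    intro z hz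
    rw [← hw]
    exact Submodule.subset_span hz
  -- `T` a UFD: the gcd `f` of `w`
  obtain ⟨f, hfw, hgf⟩ := exists_finset_gcd w
  have hfI : ∀ z ∈ Ideal.span (Set.range v), f ∣ z := by
    intro z hz
    rw [← hw] at hz
    have hle : Submodule.span T (w : Set T) ≤ Ideal.span {f} :=
      Submodule.span_le.mpr fun y hy => Ideal.mem_span_singleton.mpr (hfw y hy)
    exact Ideal.mem_span_singleton.mp (hle hz)
  have hf0 : f ≠ 0 := by
    rintro rfl
    have hI0 : Ideal.span (Set.range v) = ⊥ := by
      rw [← hw, Submodule.span_eq_bot]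
      exact fun z hz => zero_dvd_iff.mp (hfw z hz)
    have h0 := hvI ⟨x₀, hx₀T⟩
    rw [hI0, Ideal.mem_bot] at h0
    apply hx₀
    rw [← hv ⟨x₀, hx₀T⟩, h0]
    rfl
  have hf0' : (f : K) ≠ 0 := fun h => hf0 (Subtype.ext h)
  refine ⟨(f : K), f.2, hf0', ?_, ?_⟩
  · -- `f` divides every value
    intro x hx
    obtain ⟨q, hq⟩ := hfI _ (hvI ⟨x, hx⟩)
    have hq' : δ x = (f : K) * q := by
      rw [← hv ⟨x, hx⟩, hq]
      rfl
    rw [hq', mul_div_cancel_left₀ _ hf0']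
    exact q.2
  · -- saturation: `t f` divides every value, hence `t f ∣ f`, hence `t` is a unit
    intro t ht ht0 hdiv
    have key : ∀ y : T, (⟨t, ht⟩ * f : T) ∣ v y := by
      intro y
      refine ⟨⟨δ y / f / t, hdiv y y.2⟩, Subtype.ext ?_⟩
      rw [hv y]
      change δ y = t * (f : K) * (δ y / (f : K) / t)
      field_simp
    have hle : Ideal.span (Set.range v) ≤ Ideal.span {⟨t, ht⟩ * f} :=
      Ideal.span_le.mpr (by
        rintro _ ⟨y, rfl⟩
        exact Ideal.mem_span_singleton.mpr (key y))
    have hdvdw : ∀ b ∈ w, (⟨t, ht⟩ * f : T) ∣ b := fun b hb =>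
      Ideal.mem_span_singleton.mp (hle (hwI b hb))
    obtain ⟨c, hc⟩ := hgf _ hdvdw
    have hc1 : (⟨t, ht⟩ : T) * c = 1 := by
      refine mul_left_cancel₀ hf0 ?_
      rw [mul_one, ← mul_assoc, mul_comm f]
      exact hc.symm
    have h1 : t * (c : K) = 1 := by
      have h2 := congrArg Subtype.val hc1
      simpa using h2
    rw [inv_eq_of_mul_eq_one_right h1]
    exact c.2

/-- STUB `stub_saturation` of the crux `FolLU` (line `birth`), in expanded (definition-free)
form: **saturated rescaling on the local ring at the centre.** For `S ⊆ O` finitely generated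
with `Frac S = K` and `S_c = S_𝔭` (`𝔭 = S ∩ 𝔪_O`) regular, and `D ≠ 0`, there is `g ≠ 0` such
that `g • D` maps `S_c = {a / b : a b ∈ S, b ∈ O^×}` into itself and for every non-zero non-unit
`t ∈ S_c` some value `(g • D) x`, `x ∈ S_c`, is not divisible by `t` in `S_c`. (The hypotheses
`CharP`, `PerfectField`, `p`-closedness are carried but not used.)
[cite: RudakovShafarevich1976, §1] [cite: Posva2023, §2 (saturated 1-foliations)] -/
theorem stub_saturation :
  ∀ p : ℕ, p.Prime → ∀ (k K : Type) [Field k] [CharP k p] [PerfectField k] [Field K] [Algebra k K]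
    (O : ValuationSubring K) (S : Subalgebra k K) (hS : S.toSubring ≤ O.toSubring)
    (D : Derivation k K K), S.FG → IsFractionRing S K →
    IsRegularLocalRing
      (Localization.AtPrime (Ideal.comap (Subring.inclusion hS) (IsLocalRing.maximalIdeal O))) →
    D ≠ 0 → (∃ c : K, ∀ x : K, (⇑D)^[p] x = c * D x) →
    ∃ g : K, g ≠ 0 ∧
      (∀ x : K, (∃ a b : K, a ∈ S ∧ b ∈ S ∧ b ≠ 0 ∧ b⁻¹ ∈ O ∧ x = a / b) →
        ∃ a b : K, a ∈ S ∧ b ∈ S ∧ b ≠ 0 ∧ b⁻¹ ∈ O ∧ (g • D) x = a / b) ∧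
      (∀ t : K, ((∃ a b : K, a ∈ S ∧ b ∈ S ∧ b ≠ 0 ∧ b⁻¹ ∈ O ∧ t = a / b) ∧ ¬ (t ≠ 0 ∧ t⁻¹ ∈ O)) →
        t ≠ 0 → ∃ x : K, (∃ a b : K, a ∈ S ∧ b ∈ S ∧ b ≠ 0 ∧ b⁻¹ ∈ O ∧ x = a / b) ∧
          ¬ (∃ a b : K, a ∈ S ∧ b ∈ S ∧ b ≠ 0 ∧ b⁻¹ ∈ O ∧ (g • D) x / t = a / b)) := by
  intro p _hp k K _ _ _ _ _ O S hS D hfg hfrac hreg hD _hpc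
  obtain ⟨T, hTN, hTU, hT⟩ := exists_centre_subalgebra O S hS hfrac hreg
  -- `S ⊆ S_c ⊆ O`, and inverses of admissible denominators lie in `S_c`
  have hST : ∀ x ∈ S, x ∈ T := fun x hx =>
    (hT x).mpr ⟨x, 1, hx, one_mem S, one_ne_zero, by rw [inv_one]; exact one_mem O,
      (div_one x).symm⟩
  have hTO : ∀ x ∈ T, x ∈ O := by
    intro x hx
    obtain ⟨a, b, ha, -, -, hbinv, rfl⟩ := (hT x).mp hx
    rw [div_eq_mul_inv]
    exact mul_mem (hS ha : a ∈ O.toSubring) hbinv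
  have hinvT : ∀ b ∈ S, b ≠ 0 → b⁻¹ ∈ O → b⁻¹ ∈ T := fun b hb hb0 hbinv =>
    (hT _).mpr ⟨1, b, one_mem S, hb, hb0, hbinv, (one_div b).symm⟩
  -- (1) common denominator `g₀`, `g₀ D(S_c) ⊆ S_c`, `g₀ D ≠ 0` on `S_c`
  obtain ⟨g₀, -, hg₀0, hg₀D⟩ := exists_common_denominator S hfg hfrac D
  have hpres : ∀ x ∈ T, g₀ * D x ∈ T :=
    mul_deriv_mem_of_frac D S T g₀ hST (fun x hx => by
      obtain ⟨a, b, ha, hb, hb0, hbinv, rfl⟩ := (hT x).mp hx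
      exact ⟨a, b, ha, hb, hb0, hinvT b hb hb0 hbinv, rfl⟩) hg₀D
  have hne : ∃ x ∈ T, g₀ * D x ≠ 0 := by
    obtain ⟨a, ha, hDa⟩ := exists_mem_deriv_ne_zero S hfrac D hD
    exact ⟨a, hST a ha, mul_ne_zero hg₀0 hDa⟩
  -- (2)+(3) the gcd `f` of the values in the Noetherian UFD `S_c`; `g := g₀ / f`
  haveI := hTN
  haveI := hTU
  obtain ⟨f, -, hf0, hdiv, hsat⟩ :=
    exists_saturating_denominator T (fun x => g₀ * D x) hpres hne
  have hgD : ∀ x : K, ((g₀ / f) • D) x = g₀ * D x / f := fun x => by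
    rw [Derivation.smul_apply, smul_eq_mul]
    ring
  refine ⟨g₀ / f, div_ne_zero hg₀0 hf0, fun x hx => ?_, fun t ht ht0 => ?_⟩
  · rw [hgD]
    exact (hT _).mp (hdiv x ((hT x).mpr hx))
  · obtain ⟨ht, htu⟩ := ht
    by_contra hall
    push Not at hall
    refine htu ⟨ht0, hTO _ (hsat t ((hT t).mpr ht) ht0 fun x hx => ?_)⟩
    rw [← hgD]
    exact (hT _).mpr (hall x ((hT x).mp hx))

end Summit.ResolutionOfSingularities.ResolutionOfSingularities.Theorems.FolLU

end
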